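import Literature.Analysis.FluidPDE.PassiveScalarReleaseExistence
import Literature.Analysis.FluidPDE.ScalarTransportMaxPrinciple
import Literature.Analysis.FunctionSpaces.TorusSpaceTimeFields
import HarnessLib

/-!
# Bounded weak passive scalars for `L^∞_t L²_x` drifts, and bounded releases into a
# Leray–Hopf drift

Analysis/FluidPDE proof-support file (everything proved). The existence scheme of
`PassiveScalarReleaseExistence` (regularised drifts, classical solutions, weak-* compactness in
`L^∞(0,T;L²)`, identification of the limit) run with a **smooth bounded datum** `h`, `|h| ≤ H`:
the classical approximants obey the maximum principle `|θₙ| ≤ H`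
(`ScalarTransportMaxPrinciple`), and sup-norm bounds pass to weak limits
(`ae_le_of_weakLimit`: a weak limit of functions `≤ H` is `≤ H` a.e., testing against the
indicator of `{W > H}`), so the weak solution produced is bounded:
`|θ(t, x)| ≤ H` for a.e. `t` and a.e. `x` (`exists_isWeakScalarTransportOn_of_sq_of_abs_le`).
For a global Leray–Hopf drift this gives bounded RELEASES of a smooth profile at every time
`s ≥ 0` and countable families of them (`IsGlobalLerayHopf.exists_release_bounded`,
`IsGlobalLerayHopf.exists_release_bounded_family`) — the partners of the pairing identities of
the age-decoupling argument (DiPerna–Lions commutators need one bounded factor).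

## References

* R. J. DiPerna, P.-L. Lions, Invent. Math. 98 (1989), 511–547, Prop. II.1 (existence, with the
  `L^∞` bound (15) of the approximation scheme). [`DiPernaLions1989`]
* L. C. Evans, *Partial Differential Equations*, 2nd ed. (2010), §7.1.4 Thm. 8 (weak maximum
  principle for parabolic equations). [`Evans2010`]
-/

noncomputable section

open _root_.MeasureTheory _root_.TopologicalSpace _root_.Set _root_.Function _root_.Filter _root_.Metric
open _root_.Topology
open scoped ENNReal NNReal Convolution InnerProductSpace ContDiff

namespace Literature.Analysis.FluidPDE

namespace Torus

variable {d : Type*} [Fintype d]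

/-! ## Sup-norm bounds pass to weak limits -/

section WeakLimit

/-- **One-sided bounds pass to weak limits.** If `θⱼ(t, x) ≤ H` for a.e. `t ∈ (0,T)` and all `x`,
and `θⱼ ⇀ W` in the sense that `∫∫ θⱼ G → ∫∫ W G` for every space–time square-integrable `G`,
with `W ∈ L^∞(0,T; L²)` measurable, then `W(t, x) ≤ H` for a.e. `t` and a.e. `x` (test against the
indicator of `{W > H}`). [folklore] -/
theorem ae_le_of_weakLimit {T H : ℝ} {θ : ℕ → ℝ → UnitAddTorus d → ℝ} {W : ℝ → UnitAddTorus d → ℝ}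
    (hθm : ∀ j, AEStronglyMeasurable (FunctionSpaces.Torus.stLift (θ j)) (volume.restrict (Ioo 0 T ×ˢ univ)))
    (hθb : ∀ j, ∀ᵐ t ∂(volume.restrict (Ioo 0 T)), ∀ x, θ j t x ≤ H)
    (hθl : ∀ j, ∀ᵐ t ∂(volume.restrict (Ioo 0 T)), ∀ x, -H ≤ θ j t x)
    (hWm : AEStronglyMeasurable (FunctionSpaces.Torus.stLift W) (volume.restrict (Ioo 0 T ×ˢ univ)))
    {C : ℝ≥0} (hWb : ∀ᵐ t ∂(volume.restrict (Ioo 0 T)), ∫⁻ x, ‖W t x‖ₑ ^ 2 ≤ C)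
    (hlim : ∀ G : ℝ → UnitAddTorus d → ℝ,
      AEStronglyMeasurable (FunctionSpaces.Torus.stLift G) (volume.restrict (Ioo 0 T ×ˢ univ)) →
      ∫⁻ t in Ioo 0 T, ∫⁻ x, ‖G t x‖ₑ ^ 2 < ⊤ →
      Tendsto (fun j => ∫ t in Ioo 0 T, ∫ x, θ j t x * G t x) atTop (𝓝 (∫ t in Ioo 0 T, ∫ x, W t x * G t x))) :
    ∀ᵐ t ∂(volume.restrict (Ioo 0 T)), ∀ᵐ x ∂(volume : Measure (UnitAddTorus d)), W t x ≤ H := by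
  set μT : Measure ℝ := (volume : Measure ℝ).restrict (Ioo 0 T) with hμT
  haveI : IsFiniteMeasure μT := by rw [hμT]; infer_instance
  set P : Measure (ℝ × UnitAddTorus d) := μT.prod volume with hP
  -- measurable representative of `W`
  have hWu : AEStronglyMeasurable (uncurry W) P := by
    rw [hP, hμT, ← volume_restrict_prod_eq]
    exact FunctionSpaces.Torus.aestronglyMeasurable_uncurry_of_stLift_restrict hWm
  have hθu : ∀ j, AEStronglyMeasurable (uncurry (θ j)) P := fun j => by
    rw [hP, hμT, ← volume_restrict_prod_eq]
    exact FunctionSpaces.Torus.aestronglyMeasurable_uncurry_of_stLift_restrict (hθm j)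
  set W' : ℝ × UnitAddTorus d → ℝ := hWu.mk (uncurry W) with hW'
  have hW'm : Measurable W' := hWu.stronglyMeasurable_mk.measurable
  have hWW' : uncurry W =ᵐ[P] W' := hWu.ae_eq_mk
  set A : Set (ℝ × UnitAddTorus d) := {p | H < W' p} with hA
  have hAm : MeasurableSet A := measurableSet_lt measurable_const hW'm
  set G : ℝ → UnitAddTorus d → ℝ := fun t x => A.indicator (fun _ => (1 : ℝ)) (t, x) with hG
  have hGu : uncurry G = A.indicator fun _ => (1 : ℝ) := by
    funext p; rfl
  have hGmeas : Measurable (uncurry G) := by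
    rw [hGu]; exact measurable_const.indicator hAm
  have hG01 : ∀ t x, 0 ≤ G t x ∧ G t x ≤ 1 := fun t x => by
    simp only [hG]
    by_cases hp : (t, x) ∈ A
    · rw [indicator_of_mem hp]; norm_num
    · rw [indicator_of_notMem hp]; norm_num
  have hGst : AEStronglyMeasurable (FunctionSpaces.Torus.stLift G) (volume.restrict (Ioo 0 T ×ˢ univ)) :=
    FunctionSpaces.Torus.aestronglyMeasurable_stLift_of_uncurry hGmeas.aestronglyMeasurable
  have hG2 : ∫⁻ t in Ioo 0 T, ∫⁻ x, ‖G t x‖ₑ ^ 2 < ⊤ := by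
    have h1 : ∫⁻ _ : UnitAddTorus d, (1 : ℝ≥0∞) = 1 := by rw [lintegral_const, measure_univ, mul_one]
    calc ∫⁻ t in Ioo 0 T, ∫⁻ x, ‖G t x‖ₑ ^ 2 ≤ ∫⁻ _ in Ioo 0 T, ∫⁻ _ : UnitAddTorus d, (1 : ℝ≥0∞) := by
          refine lintegral_mono fun t => lintegral_mono fun x => ?_
          rw [Real.enorm_eq_ofReal (hG01 t x).1, ← ENNReal.ofReal_pow (hG01 t x).1, ← ENNReal.ofReal_one]
          exact ENNReal.ofReal_le_ofReal (by nlinarith [(hG01 t x).1, (hG01 t x).2])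
      _ < ⊤ := by
          rw [h1, setLIntegral_const, one_mul]
          exact measure_Ioo_lt_top
  -- `∫∫ θⱼ G ≤ H ∫∫ G`
  have hGi : Integrable (uncurry G) P := by
    refine Integrable.mono' (integrable_const (1 : ℝ)) hGmeas.aestronglyMeasurable (Eventually.of_forall fun p => ?_)
    change ‖G p.1 p.2‖ ≤ 1
    rw [Real.norm_eq_abs, abs_of_nonneg (hG01 p.1 p.2).1]
    exact (hG01 p.1 p.2).2
  have hθGi : ∀ j, Integrable (fun p : ℝ × UnitAddTorus d => θ j p.1 p.2 * G p.1 p.2) P := by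
    intro j
    refine Integrable.mono' (integrable_const (|H| * 1)) ((hθu j).mul hGmeas.aestronglyMeasurable) ?_
    have h1 : ∀ᵐ p ∂P, θ j p.1 p.2 ≤ H ∧ -H ≤ θ j p.1 p.2 := by
      have h2 : ∀ᵐ t ∂μT, ∀ x : UnitAddTorus d, θ j t x ≤ H ∧ -H ≤ θ j t x := by
        filter_upwards [hθb j, hθl j] with t h1 h2 x
        exact ⟨h1 x, h2 x⟩
      have := (Measure.quasiMeasurePreserving_fst (μ := μT) (ν := (volume : Measure (UnitAddTorus d)))).ae h2
      filter_upwards [this] with p hp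
      exact hp p.2
    filter_upwards [h1] with p hp
    have hθabs : |θ j p.1 p.2| ≤ |H| :=
      abs_le.2 ⟨by linarith [neg_abs_le H, le_abs_self H, hp.2], hp.1.trans (le_abs_self H)⟩
    change ‖θ j p.1 p.2 * G p.1 p.2‖ ≤ |H| * 1
    rw [norm_mul, Real.norm_eq_abs, Real.norm_eq_abs, abs_of_nonneg (hG01 p.1 p.2).1]
    exact mul_le_mul hθabs (hG01 p.1 p.2).2 (hG01 p.1 p.2).1 (abs_nonneg H)
  have hle_j : ∀ j, ∫ t in Ioo 0 T, ∫ x, θ j t x * G t x ≤ H * ∫ p, uncurry G p ∂P := by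
    intro j
    rw [← integral_prod _ (hθGi j), ← MeasureTheory.integral_const_mul]
    refine integral_mono_ae (hθGi j) (hGi.const_mul H) ?_
    have h2 : ∀ᵐ t ∂μT, ∀ x : UnitAddTorus d, θ j t x ≤ H := hθb j
    have := (Measure.quasiMeasurePreserving_fst (μ := μT) (ν := (volume : Measure (UnitAddTorus d)))).ae h2
    filter_upwards [this] with p hp
    exact mul_le_mul_of_nonneg_right (hp p.2) (hG01 p.1 p.2).1
  -- pass to the limit
  have hWGi : Integrable (fun p : ℝ × UnitAddTorus d => W p.1 p.2 * G p.1 p.2) P := by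
    have hW2 : MemLp (uncurry W) 2 P := by
      refine ⟨hWu, ?_⟩
      rw [eLpNorm_eq_lintegral_rpow_enorm_toReal two_ne_zero ENNReal.ofNat_ne_top, ENNReal.toReal_ofNat]
      refine ENNReal.rpow_lt_top_of_nonneg (by norm_num) (ne_of_lt ?_)
      have e : ∫⁻ p, ‖uncurry W p‖ₑ ^ (2 : ℝ) ∂P = ∫⁻ t, ∫⁻ x, ‖W t x‖ₑ ^ 2 ∂volume ∂μT := by
        rw [hP, lintegral_prod _ (hWu.enorm.pow_const _)]
        refine lintegral_congr fun t => lintegral_congr fun x => ?_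
        rw [ENNReal.rpow_two]; rfl
      rw [e]
      calc ∫⁻ t, ∫⁻ x, ‖W t x‖ₑ ^ 2 ∂volume ∂μT ≤ ∫⁻ _, (C : ℝ≥0∞) ∂μT := lintegral_mono_ae hWb
        _ < ⊤ := by
            rw [lintegral_const]
            exact ENNReal.mul_lt_top ENNReal.coe_lt_top (measure_lt_top _ _)
    have hG2' : MemLp (uncurry G) 2 P := memLp_top_of_bound hGmeas.aestronglyMeasurable 1
      (Eventually.of_forall fun p => by
        change ‖G p.1 p.2‖ ≤ 1
        rw [Real.norm_eq_abs, abs_of_nonneg (hG01 p.1 p.2).1]; exact (hG01 p.1 p.2).2) |>.mono_exponent le_top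
    exact hW2.integrable_mul hG2'
  have hlimG := hlim G hGst hG2
  have hle : ∫ p, W p.1 p.2 * G p.1 p.2 ∂P ≤ H * ∫ p, uncurry G p ∂P := by
    rw [integral_prod _ hWGi]
    exact le_of_tendsto' hlimG hle_j
  -- `∫_P 1_A (W' - H) ≤ 0` with a nonnegative integrand
  set F : ℝ × UnitAddTorus d → ℝ := fun p => A.indicator (fun p => W' p - H) p with hF
  have hF0 : ∀ p, 0 ≤ F p := fun p => by
    simp only [hF]
    by_cases hp : p ∈ A
    · rw [indicator_of_mem hp]; exact (sub_pos.2 hp).le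
    · rw [indicator_of_notMem hp]
  have hFeq : F =ᵐ[P] fun p => W p.1 p.2 * G p.1 p.2 - H * uncurry G p := by
    filter_upwards [hWW'] with p hp
    have hp' : W p.1 p.2 = W' p := hp
    change A.indicator (fun p => W' p - H) p =
      W p.1 p.2 * A.indicator (fun _ => (1 : ℝ)) p - H * A.indicator (fun _ => (1 : ℝ)) p
    by_cases hpA : p ∈ A
    · rw [indicator_of_mem hpA, indicator_of_mem hpA, hp']; ring
    · rw [indicator_of_notMem hpA, indicator_of_notMem hpA]; ring
  have hFi : Integrable F P := (hWGi.sub (hGi.const_mul H)).congr hFeq.symm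
  have hFint : ∫ p, F p ∂P ≤ 0 := by
    rw [integral_congr_ae hFeq, integral_sub hWGi (hGi.const_mul H), MeasureTheory.integral_const_mul]
    linarith
  have hF00 : F =ᵐ[P] 0 := by
    have := (integral_eq_zero_iff_of_nonneg (fun p => hF0 p) hFi).1 (le_antisymm hFint (integral_nonneg hF0))
    exact this
  have hA0 : ∀ᵐ p ∂P, W' p ≤ H := by
    filter_upwards [hF00] with p hp
    by_contra hgt
    rw [not_le] at hgt
    have hpA : p ∈ A := hgt
    simp only [hF, Pi.zero_apply, indicator_of_mem hpA] at hp
    linarith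
  have hprod : ∀ᵐ p ∂P, W p.1 p.2 ≤ H := by
    filter_upwards [hA0, hWW'] with p h1 h2
    simp only [uncurry] at h2
    rw [h2]; exact h1
  rw [hP] at hprod
  exact Measure.ae_ae_of_ae_prod hprod

end WeakLimit

/-! ## Bounded weak solutions for `L^∞_t L²_x` drifts -/

section Existence

variable [DecidableEq d]

/-- **Existence of BOUNDED weak solutions of the passive scalar equation for an `L^∞_t L²_x`
drift and a smooth bounded datum** (DiPerna–Lions 1989, Prop. II.1 regularisation scheme, with
the maximum principle on the classical approximants and its weak-* stability): for `κ > 0`,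
`T > 0`, a smooth datum `h` with `|h| ≤ H` and a space–time measurable drift `u` with
`∫ ‖u(t)‖² ≤ M` for a.e. `t ∈ (0,T)`, weakly divergence free at a.e. time, there is a weak
solution `θ` of `∂ₜθ + u·∇θ = κΔθ` on `T^d × [0,T)` with datum `h`,
`∫ |θ(t)|² ≤ ‖h‖²_{L²}` for a.e. `t`, and `|θ(t, x)| ≤ H` for a.e. `t` and a.e. `x`.
[cite: DiPernaLions1989, Prop. II.1] -/
theorem exists_isWeakScalarTransportOn_of_sq_of_abs_le {T κ : ℝ} (hκ : 0 < κ) (hT : 0 < T)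
    {u : ℝ → UnitAddTorus d → EuclideanSpace ℝ d} {h : UnitAddTorus d → ℝ} (hh : FunctionSpaces.Torus.IsSmooth h)
    {H : ℝ} (hH : ∀ x, |h x| ≤ H)
    (hum : AEStronglyMeasurable (FunctionSpaces.Torus.stLift u) (volume.restrict (Ioo 0 T ×ˢ univ)))
    {M : ℝ≥0} (hub : ∀ᵐ t ∂(volume.restrict (Ioo 0 T)), ∫⁻ x, ‖u t x‖ₑ ^ 2 ≤ M)
    (hdiv : ∀ᵐ t ∂(volume.restrict (Ioo 0 T)), FunctionSpaces.Torus.IsWeaklyDivFree (u t)) :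
    ∃ θ : ℝ → UnitAddTorus d → ℝ, IsWeakScalarTransportOn T κ u h θ ∧
      (∀ᵐ t ∂(volume.restrict (Ioo 0 T)), ∫⁻ x, ‖θ t x‖ₑ ^ 2 ≤ eLpNorm h 2 volume ^ 2) ∧
      ∀ᵐ t ∂(volume.restrict (Ioo 0 T)), ∀ᵐ x ∂(volume : Measure (UnitAddTorus d)), |θ t x| ≤ H := by
  have hh2 : MemLp h 2 volume := hh.memLp 2
  -- the drift is square integrable on `(0,T) × T^d`
  have hu2 : ∫⁻ t in Ioo 0 T, ∫⁻ x, ‖u t x‖ₑ ^ 2 < ⊤ :=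
    calc ∫⁻ t in Ioo 0 T, ∫⁻ x, ‖u t x‖ₑ ^ 2 ≤ ∫⁻ _ in Ioo 0 T, (M : ℝ≥0∞) := lintegral_mono_ae hub
      _ < ⊤ := by
          rw [lintegral_const, Measure.restrict_apply_univ]
          exact ENNReal.mul_lt_top ENNReal.coe_lt_top measure_Ioo_lt_top
  -- regularised drifts
  obtain ⟨v, hvs, hvdiv, hvlim⟩ := exists_smooth_isDivFree_tendsto_eLpNorm_sub_of_sq hum hu2 hdiv
  -- classical solutions of the regularised problems, datum `h`
  have hcl : ∀ n, ∃ θ : ℝ → UnitAddTorus d → ℝ,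
      IsClassicalScalarTransportOn (Icc 0 T) κ (v n) θ ∧ θ 0 = h := by
    intro n
    obtain ⟨θ, hθ, h0, -⟩ := exists_unique_isClassicalScalarTransportOn_of_forced
      exists_unique_isClassicalScalarTransportForcedOn_holds hκ hT
      (FunctionSpaces.Torus.isSmoothSpaceTimeOn_of_contDiff (hvs n) _) (fun t _ => hvdiv n t) hh
    exact ⟨θ, hθ, h0⟩
  choose θ hθ hθ0 using hcl
  have hsol : ∀ n, IsWeakScalarTransportOn T κ (v n) h (θ n) := by
    intro n
    have h := IsClassicalScalarTransportOn.isWeakScalarTransportOn_holds (hθ n) subset_rfl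
    rwa [hθ0 n] at h
  -- the maximum principle `|θₙ| ≤ H` on `[0, T]`
  have hup : ∀ n, ∀ t ∈ Icc 0 T, ∀ x, θ n t x ≤ H := fun n =>
    IsClassicalScalarTransportOn.le_of_le hκ.le (hθ n) fun x => by
      rw [hθ0 n]; exact (le_abs_self _).trans (hH x)
  have hlow : ∀ n, ∀ t ∈ Icc 0 T, ∀ x, -H ≤ θ n t x := fun n =>
    IsClassicalScalarTransportOn.ge_of_ge hκ.le (hθ n) fun x => by
      rw [hθ0 n]; exact (neg_le_neg (hH x)).trans (neg_abs_le _)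
  -- the a priori bound `∫ |θₙ(t)|² ≤ ‖h‖₂²` for `t ∈ [0, T]`
  set C : ℝ≥0 := (eLpNorm h 2 volume ^ 2).toNNReal with hC
  have hCeq : (C : ℝ≥0∞) = eLpNorm h 2 volume ^ 2 :=
    ENNReal.coe_toNNReal (ENNReal.pow_ne_top hh2.eLpNorm_ne_top)
  have hbd' : ∀ n, ∀ t ∈ Icc 0 T, ∫⁻ x, ‖θ n t x‖ₑ ^ 2 ≤ C := by
    intro n t ht
    have hθc : Continuous (θ n t) := ((hθ n).smooth_scalar.isSmooth_slice ht).continuous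
    have hE := IsClassicalScalarTransportOn.scalarL2Sq_add_scalarDissipation_holds (hθ n) ht.1
      (Icc_subset_Icc_right ht.2)
    have hD := scalarDissipation_nonneg hκ.le (θ n) ht.1
    have hle : scalarL2Sq (θ n t) ≤ scalarL2Sq h := by rw [← hθ0 n]; linarith
    calc ∫⁻ x, ‖θ n t x‖ₑ ^ 2 = ENNReal.ofReal (scalarL2Sq (θ n t)) := lintegral_enorm_sq_eq_ofReal_integral_sq hθc
      _ ≤ ENNReal.ofReal (scalarL2Sq h) := ENNReal.ofReal_le_ofReal hle
      _ = eLpNorm h 2 volume ^ 2 := by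
          rw [scalarL2Sq, ← lintegral_enorm_sq_eq_ofReal_integral_sq hh.continuous,
            FunctionSpaces.eLpNorm_two_pow_two_eq_lintegral]
      _ = C := hCeq.symm
  have hbd : ∀ n, ∀ᵐ t ∂(volume.restrict (Ioo 0 T)), ∫⁻ x, ‖θ n t x‖ₑ ^ 2 ≤ C := fun n =>
    (ae_restrict_mem measurableSet_Ioo).mono fun t ht => hbd' n t (Ioo_subset_Icc_self ht)
  -- weak-* compactness and identification of the limit
  obtain ⟨φ, hφ, W, hWm, hWb, hWlim⟩ :=
    FunctionSpaces.Torus.exists_strictMono_weakLimit_of_lintegral_sq_le (fun n => (hsol n).aestronglyMeasurable) hbd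
  have hglim : Tendsto (fun _ : ℕ => eLpNorm (h - h) 2 volume) atTop (𝓝 0) := by
    simp only [sub_self, eLpNorm_zero]
    exact tendsto_const_nhds
  refine ⟨W, IsWeakScalarTransportOn.of_tendsto_of_lintegral_sq_le (fun j => hsol (φ j)) (fun j => hbd (φ j)) hWm hWb hWlim
    hum hub hdiv (hvlim.comp hφ.tendsto_atTop) hh2 (fun _ => hh2) hglim, ?_, ?_⟩
  · filter_upwards [hWb] with t ht
    rwa [hCeq] at ht
  · -- the bound `|W| ≤ H` from both one-sided bounds
    have hθm : ∀ j, AEStronglyMeasurable (FunctionSpaces.Torus.stLift (θ (φ j))) (volume.restrict (Ioo 0 T ×ˢ univ)) :=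
      fun j => (hsol (φ j)).aestronglyMeasurable
    have hb1 : ∀ j, ∀ᵐ t ∂(volume.restrict (Ioo 0 T)), ∀ x, θ (φ j) t x ≤ H := fun j =>
      (ae_restrict_mem measurableSet_Ioo).mono fun t ht x => hup (φ j) t (Ioo_subset_Icc_self ht) x
    have hb2 : ∀ j, ∀ᵐ t ∂(volume.restrict (Ioo 0 T)), ∀ x, -H ≤ θ (φ j) t x := fun j =>
      (ae_restrict_mem measurableSet_Ioo).mono fun t ht x => hlow (φ j) t (Ioo_subset_Icc_self ht) x
    have hupper := ae_le_of_weakLimit hθm hb1 hb2 hWm hWb hWlim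
    -- lower bound: apply the one-sided lemma to `-θ`, `-W`
    have hθm' : ∀ j, AEStronglyMeasurable (FunctionSpaces.Torus.stLift (fun t x => -θ (φ j) t x))
        (volume.restrict (Ioo 0 T ×ˢ univ)) := fun j => (hθm j).neg
    have hWm' : AEStronglyMeasurable (FunctionSpaces.Torus.stLift (fun t x => -W t x)) (volume.restrict (Ioo 0 T ×ˢ univ)) :=
      hWm.neg
    have hb1' : ∀ j, ∀ᵐ t ∂(volume.restrict (Ioo 0 T)), ∀ x, (fun t x => -θ (φ j) t x) t x ≤ H := fun j =>
      (hb2 j).mono fun t ht x => by simpa using neg_le_neg (ht x)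
    have hb2' : ∀ j, ∀ᵐ t ∂(volume.restrict (Ioo 0 T)), ∀ x, -H ≤ (fun t x => -θ (φ j) t x) t x := fun j =>
      (hb1 j).mono fun t ht x => by simpa using neg_le_neg (ht x)
    have hWb' : ∀ᵐ t ∂(volume.restrict (Ioo 0 T)), ∫⁻ x, ‖(fun t x => -W t x) t x‖ₑ ^ 2 ≤ C := by
      filter_upwards [hWb] with t ht
      simpa only [enorm_neg] using ht
    have hWlim' : ∀ G : ℝ → UnitAddTorus d → ℝ,
        AEStronglyMeasurable (FunctionSpaces.Torus.stLift G) (volume.restrict (Ioo 0 T ×ˢ univ)) →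
        ∫⁻ t in Ioo 0 T, ∫⁻ x, ‖G t x‖ₑ ^ 2 < ⊤ →
        Tendsto (fun j => ∫ t in Ioo 0 T, ∫ x, (fun t x => -θ (φ j) t x) t x * G t x) atTop
          (𝓝 (∫ t in Ioo 0 T, ∫ x, (fun t x => -W t x) t x * G t x)) := by
      intro G hG1 hG2
      have h1 := (hWlim G hG1 hG2).neg
      have e : ∀ (f : ℝ → UnitAddTorus d → ℝ), -(∫ t in Ioo 0 T, ∫ x, f t x * G t x) =
          ∫ t in Ioo 0 T, ∫ x, (fun t x => -f t x) t x * G t x := by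
        intro f
        rw [← integral_neg]
        refine integral_congr_ae (Eventually.of_forall fun t => ?_)
        dsimp only
        rw [← integral_neg]
        exact integral_congr_ae (Eventually.of_forall fun x => by ring)
      simpa only [e] using h1
    have hlower := ae_le_of_weakLimit hθm' hb1' hb2' hWm' hWb' hWlim'
    filter_upwards [hupper, hlower] with t h1 h2
    filter_upwards [h1, h2] with x hx1 hx2
    have hx2' : -W t x ≤ H := hx2
    exact abs_le.2 ⟨by linarith, hx1⟩

end Existence

/-! ## Bounded releases into a Leray–Hopf drift -/

section Release

variable [DecidableEq d]

/-- **Bounded releases of a smooth profile into a global Leray–Hopf drift exist.** For a global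
Leray–Hopf velocity field `v` on `T^d`, `κ > 0`, `T > 0`, `s ≥ 0` and a smooth profile `h` with
`|h| ≤ H` there is a weak solution `ϑ` of `∂_τϑ + v(s+τ)·∇ϑ = κΔϑ` on `T^d × [0,T)` with datum
`h`, with `∫ |ϑ(τ)|² ≤ ‖h‖²_{L²}` for a.e. `τ` and `|ϑ(τ, x)| ≤ H` for a.e. `τ` and a.e. `x`.
[cite: DiPernaLions1989, Prop. II.1] -/
theorem IsGlobalLerayHopf.exists_release_bounded {ν : ℝ} {f : ℝ → UnitAddTorus d → EuclideanSpace ℝ d}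
    {v₀ : UnitAddTorus d → EuclideanSpace ℝ d} {v : ℝ → UnitAddTorus d → EuclideanSpace ℝ d}
    (hv : IsGlobalLerayHopf ν f v₀ v) {κ T s : ℝ} (hκ : 0 < κ) (hT : 0 < T) (hs : 0 ≤ s)
    {h : UnitAddTorus d → ℝ} (hh : FunctionSpaces.Torus.IsSmooth h) {H : ℝ} (hH : ∀ x, |h x| ≤ H) :
    ∃ ϑ : ℝ → UnitAddTorus d → ℝ, IsWeakScalarTransportOn T κ (fun τ => v (s + τ)) h ϑ ∧
      (∀ᵐ τ ∂(volume.restrict (Ioo 0 T)), ∫⁻ x, ‖ϑ τ x‖ₑ ^ 2 ≤ eLpNorm h 2 volume ^ 2) ∧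
      ∀ᵐ τ ∂(volume.restrict (Ioo 0 T)), ∀ᵐ x ∂(volume : Measure (UnitAddTorus d)), |ϑ τ x| ≤ H := by
  have hTs : 0 < T + s := by linarith
  have hLH := hv (T + s) hTs
  have hfun : (fun τ => v (s + τ)) = fun τ => v (τ + s) := by
    funext τ; rw [add_comm]
  rw [hfun]
  have hum : AEStronglyMeasurable (FunctionSpaces.Torus.stLift fun τ => v (τ + s))
      (volume.restrict (Ioo 0 T ×ˢ univ)) :=
    aestronglyMeasurable_stLift_translate hs le_rfl hLH.weak.1
  obtain ⟨M, hM⟩ := hLH.energy_bound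
  have hub : ∀ᵐ τ ∂(volume.restrict (Ioo 0 T)), ∫⁻ x, ‖v (τ + s) x‖ₑ ^ 2 ≤ M := by
    refine ae_restrict_Ioo_comp_add_right s (P := fun t => ∫⁻ x, ‖v t x‖ₑ ^ 2 ≤ M) ?_
    rw [zero_add]
    exact ae_restrict_of_ae_restrict_of_subset (Ioo_subset_Ioo hs le_rfl) hM
  have hdiv : ∀ᵐ τ ∂(volume.restrict (Ioo 0 T)), FunctionSpaces.Torus.IsWeaklyDivFree (v (τ + s)) := by
    refine ae_restrict_Ioo_comp_add_right s (P := fun t => FunctionSpaces.Torus.IsWeaklyDivFree (v t)) ?_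
    rw [zero_add]
    exact ae_restrict_of_ae_restrict_of_subset (Ioo_subset_Ioo hs le_rfl) hLH.weak.ae_isWeaklyDivFree
  exact exists_isWeakScalarTransportOn_of_sq_of_abs_le hκ hT hh hH hum hub hdiv

/-- **Countable families of bounded releases** (choice): for a global Leray–Hopf drift, `κ > 0`,
a horizon `T > 0`, a smooth profile `h` with `|h| ≤ H` and any sequence of release times
`σ n ≥ 0` there is a family `ϑ n` of releases of `h` at the times `σ n`, each with
`∫ |ϑ n (τ)|² ≤ ‖h‖²_{L²}` for a.e. `τ ∈ (0,T)` and `|ϑ n (τ, x)| ≤ H` for a.e. `τ` and a.e. `x`.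
[cite: DiPernaLions1989, Prop. II.1] -/
theorem IsGlobalLerayHopf.exists_release_bounded_family {ν : ℝ} {f : ℝ → UnitAddTorus d → EuclideanSpace ℝ d}
    {v₀ : UnitAddTorus d → EuclideanSpace ℝ d} {v : ℝ → UnitAddTorus d → EuclideanSpace ℝ d}
    (hv : IsGlobalLerayHopf ν f v₀ v) {κ T : ℝ} (hκ : 0 < κ) (hT : 0 < T) {σ : ℕ → ℝ}
    (hσ : ∀ n, 0 ≤ σ n) {h : UnitAddTorus d → ℝ} (hh : FunctionSpaces.Torus.IsSmooth h) {H : ℝ}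
    (hH : ∀ x, |h x| ≤ H) :
    ∃ ϑ : ℕ → ℝ → UnitAddTorus d → ℝ, ∀ n,
      IsWeakScalarTransportOn T κ (fun τ => v (σ n + τ)) h (ϑ n) ∧
        (∀ᵐ τ ∂(volume.restrict (Ioo 0 T)), ∫⁻ x, ‖ϑ n τ x‖ₑ ^ 2 ≤ eLpNorm h 2 volume ^ 2) ∧
        ∀ᵐ τ ∂(volume.restrict (Ioo 0 T)), ∀ᵐ x ∂(volume : Measure (UnitAddTorus d)), |ϑ n τ x| ≤ H := by
  choose ϑ hϑ using fun n => hv.exists_release_bounded hκ hT (hσ n) hh hH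
  exact ⟨ϑ, hϑ⟩

end Release

end Torus

end Literature.Analysis.FluidPDE
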